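import Summits.BirchSwinnertonDyer.Rank1Residual.Partition.CornersAll
import Summits.BirchSwinnertonDyer.Rank1Residual.Partition.CornersThree
import Literature.NumberTheory.EllipticCurves.Wuthrich2014.ThreeAdicImageSupersingularProofs
import HarnessLib

/-!
# The §I HEADLINE chain with Wuthrich 2014 Lemma 20 DISCHARGED: thirteen named facts, not fourteen
# (cell `b2b-bsdres`, team n1011, seat p02; row T-b2-HL)

HONEST FRAMING (run/shared/lean/b2b/bsd-rank1-residual/, verbatim in every file): the goal of the
cell is to DELETE the COMBINATION-SHAPED residual classes of the Birch–Swinnerton-Dyer formula for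
ALL analytic-rank `≤ 1` elliptic curves over `ℚ` — "full BSD formula for every rank `≤ 1` curve in
class `C`" assembled STRICTLY from published theorems — so that the rank-`≤ 1` remainder becomes
exactly the CONSTRUCTION-SHAPED classes, which are TYPED (missing-input `Prop`s), NOT attempted.
This is not "finishing BSD". Research route; nothing is booked by this file; no label or mark of
RESIDUAL-MAP.md changes; no definition, no named fact (theorems only).

## What this file records

The partition chain `Partition/Bsdp.lean` → `Corners.lean` → `CornersAll.lean` / `CornersThree.lean`
(rmap-1 / rmap-3) carries FOURTEEN named published facts; one of them, the binder
`hW20 : Wuthrich2014.lemma20_surjective_threeAdic_of_semistable` (registry A9: C. Wuthrich,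
Doc. Math. 19 (2014), Lemma 20, p. 399 — "Let `p = 3` and suppose `p²` does not divide the
conductor `N`. If `ρ̄` is surjective then `ρ` is surjective, too"), enters at exactly ONE root,
`RowC16.bsdp` (row C16 = Yan–Zhu 2026 Thm. 4.15 at a good ordinary `3` with `E[3]` irreducible,
(Im) witnessed by `surj(3)` through Lemma 20 or by a ramified multiplicative prime).

Since 2026-08-21 that named fact is a THEOREM of the tree:
`Wuthrich2014.lemma20_surjective_threeAdic_of_semistable_holds`
(`Literature/NumberTheory/EllipticCurves/Wuthrich2014/ThreeAdicImageSupersingularProofs.lean`: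
good ordinary and multiplicative `3` by inertia words — unit lit-kato; good supersingular `3` by
the wild ramification of the `9`-torsion of the height-`2` formal group — team n1011 seat p02, and
independently lit-kato by an inertia count). This file feeds it in, once, at the root, and
re-exports the headline statements with THIRTEEN binders (`hSk`, `hBCS`, `hJSW`, `hCGS`, `hGV`,
`hGr`, `hmod`, `hmodP`, `hGZK`, `hCM`, `hKob`, `hYZ`, `hLLT`; PUB\* flags travel with
`hBCS` / `hJSW` / `hYZ` / `hKob` exactly as before — nothing else changes):

* `RowC16.bsdp_noL20` — row C16 ⇒ `BSD(E,p)` from `hYZ`, `hmod`, `hGZK` alone;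
* `bsdp_three_of_goodOrd_of_surj_noL20` — EVERY `E/ℚ` of analytic rank `≤ 1`, `3` good ordinary,
  `ρ̄_{E,3}` onto ⇒ `BSD(E,3)` from THREE named facts (Yan–Zhu 2026 Thm. 4.15 [PUB\*,
  `YZ26@3-BF-ERL-Ohta`], modularity, Gross–Zagier–Kolyvagin);
* `bsdp_of_covered_noL20`, `bsdp_or_residual_noL20`, `residual_of_not_bsdp_noL20` — the partition
  lemma's consequence forms (`Partition/Bsdp.lean`) on thirteen facts;
* `bsdp_of_not_corner_noL20`, `bsdp_of_not_corner_noL20'` — the STRONG PARTIAL THEOREM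
  (`Partition/Corners.lean`, coordinator ruling 2026-08-20T22:24Z) on thirteen facts;
* `bsdp_allCurves_of_not_corner_of_not_cornerF_noL20` — the all-curves form with the CM corner
  explicit (`Partition/CornersAll.lean`);
* `bsdp_three_of_not_corner_noL20` — the `p = 3` form with its seven corners
  (`Partition/CornersThree.lean`) — the only prime at which Lemma 20 has content.

Every proof is the corresponding fourteen-fact theorem applied to `…_holds`; the originals are not
touched (append-only tree; their owners may alias these forms). Other consumers of the binder
(`hL20` / `hW20` / `h20` in the X10 / X11 / X4-additive chains) are fed by their owners.

References: [Wuthrich2014] C. Wuthrich, Doc. Math. 19 (2014) 381–402, Lemma 20 (p. 399);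
RESIDUAL-MAP.md §I (HEADLINE DELIVERABLE); CITED-FACTS.md 'lit seat GEN 45 block' (A9 →
DISCHARGED); `Partition/Bsdp.lean`, `Partition/Corners.lean`, `Partition/CornersAll.lean`,
`Partition/CornersThree.lean`.
-/

namespace Summit.BirchSwinnertonDyer.Rank1Residual

open WeierstrassCurve Literature.NumberTheory.EllipticCurves
  Literature.NumberTheory.EllipticCurves.Rank1Residual Literature.NumberTheory.EllipticCurves.ModularForms
open scoped NumberField

section Curve

variable {W : WeierstrassCurve ℚ} [W.IsElliptic] [W.IsGloballyMinimal] {p : ℕ} [Fact p.Prime]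

/-! ### The root: row C16 without the Lemma-20 binder -/

/-- **C16 ⇒ `BSD(E,p)` on THREE named facts**: Yan–Zhu 2026 Thm. 4.15 (`hYZ`) at `p = 3` good
ordinary irreducible, with (Im) witnessed either by `3`-adic surjectivity ⇐ `surj(3)` at a good `3`
— now the tree THEOREM `Wuthrich2014.lemma20_surjective_threeAdic_of_semistable_holds` (Wuthrich
2014 Lemma 20) — or by the ramified multiplicative prime; rank clause by modularity (`hmod`) and
Gross–Zagier–Kolyvagin (`hGZK`). `RowC16.bsdp` with its `hW20` binder discharged.
[cite: YanZhu2024MainConjNonCM, Thm. 4.15 (§4.6)] [cite: Wuthrich2014, Lemma 20 (p. 399)] -/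
theorem RowC16.bsdp_noL20 (hYZ : YanZhu2026.thm415_padicValRat_bsd_rank_le_one)
    (hmod : hasEntireLFunction_rat) (hGZK : rank_eq_analyticRank_of_analyticRank_le_one)
    (hr : W.analyticRank ≤ 1) (h : RowC16 W p) : BSDp W p :=
  RowC16.bsdp hYZ Wuthrich2014.lemma20_surjective_threeAdic_of_semistable_holds hmod hGZK hr h

/-- **Every `E/ℚ` of analytic rank `≤ 1`, `3` good ORDINARY, `ρ̄_{E,3}` SURJECTIVE ⇒ `BSD(E,3)` —
from THREE named published facts** (Yan–Zhu 2026 Thm. 4.15 [PUB\*, flag `YZ26@3-BF-ERL-Ohta`],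
modularity, Gross–Zagier–Kolyvagin): the pair is in row C16 (`E[3]` irreducible because `ρ̄` is
onto; the (Im) hypothesis of Thm. 4.15 is Wuthrich's Lemma 20, a tree theorem). The fourteen-fact
form is `bsdp_three_of_goodOrd_of_surj` (`Partition/CornersThree.lean`, RESIDUAL-MAP §S.2 row
'§A good ordinary, ρ̄ surjective'). [cite: YanZhu2024MainConjNonCM, Thm. 4.15 (§4.6)]
[cite: Wuthrich2014, Lemma 20 (p. 399)] -/
theorem bsdp_three_of_goodOrd_of_surj_noL20 (hYZ : YanZhu2026.thm415_padicValRat_bsd_rank_le_one)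
    (hmod : hasEntireLFunction_rat) (hGZK : rank_eq_analyticRank_of_analyticRank_le_one)
    (hr : W.analyticRank ≤ 1) (hgo : GoodOrd W 3) (hsurj : Surj W 3) : BSDp W 3 :=
  RowC16.bsdp_noL20 hYZ hmod hGZK hr ⟨rfl, hgo, irr_of_surj W 3 hsurj, Or.inl hsurj⟩

/-! ### The partition lemma's consequence forms on thirteen facts -/

/-- **Covered ⇒ `BSD(E,p)`, thirteen named facts** (the fourteen of `bsdp_of_covered` less
Wuthrich 2014 Lemma 20, now `…_holds`); PUB\* flags travel with the facts of C2 / C3-ss / C10 /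
C16 as before. [folklore] -/
theorem bsdp_of_covered_noL20 (hSk : Skinner2016.thmC_padicValRat_bsd_rank_zero)
    (hBCS : BurungaleCastellaSkinner2025.cor131_padicValRat_bsd_rank_le_one)
    (hJSW : JetchevSkinnerWan2017.thm121_padicValRat_bsd_rank_one)
    (hCGS : CastellaGrossiSkinner2025.thmD_padicValRat_bsd_rank_le_one)
    (hGV : GreenbergVatsal2000.thm13_charIdeal_eq_of_gvPar) (hGr : greenberg_charValue_rankZero)
    (hmod : hasEntireLFunction_rat) (hmodP : nonempty_modularParametrizationData)
    (hGZK : rank_eq_analyticRank_of_analyticRank_le_one)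
    (hCM : bsdTriple_of_hasCM_of_L_one_ne_zero) (hKob : Kobayashi2013.cor14_bsdp_of_cm_rank_one)
    (hYZ : YanZhu2026.thm415_padicValRat_bsd_rank_le_one)
    (hLLT : LiLiuTian2024.thm11_bsdp_of_cm_rank_one)
    (hr : W.analyticRank ≤ 1) (h : Covered W p) : BSDp W p :=
  bsdp_of_covered hSk hBCS hJSW hCGS hGV hGr hmod hmodP hGZK hCM hKob hYZ
    Wuthrich2014.lemma20_surjective_threeAdic_of_semistable_holds hLLT hr h

/-- **The partition lemma, consequence form, thirteen named facts**: every pair `(E, p)` with `E/ℚ`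
of analytic rank `≤ 1` satisfies Miller's `BSD(E,p)` or lies in a residual class (`Residual W p`).
`bsdp_or_residual` with the Lemma-20 binder discharged. [folklore] -/
theorem bsdp_or_residual_noL20 (hSk : Skinner2016.thmC_padicValRat_bsd_rank_zero)
    (hBCS : BurungaleCastellaSkinner2025.cor131_padicValRat_bsd_rank_le_one)
    (hJSW : JetchevSkinnerWan2017.thm121_padicValRat_bsd_rank_one)
    (hCGS : CastellaGrossiSkinner2025.thmD_padicValRat_bsd_rank_le_one)
    (hGV : GreenbergVatsal2000.thm13_charIdeal_eq_of_gvPar) (hGr : greenberg_charValue_rankZero)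
    (hmod : hasEntireLFunction_rat) (hmodP : nonempty_modularParametrizationData)
    (hGZK : rank_eq_analyticRank_of_analyticRank_le_one)
    (hCM : bsdTriple_of_hasCM_of_L_one_ne_zero) (hKob : Kobayashi2013.cor14_bsdp_of_cm_rank_one)
    (hYZ : YanZhu2026.thm415_padicValRat_bsd_rank_le_one)
    (hLLT : LiLiuTian2024.thm11_bsdp_of_cm_rank_one)
    (hr : W.analyticRank ≤ 1) : BSDp W p ∨ Residual W p :=
  bsdp_or_residual hSk hBCS hJSW hCGS hGV hGr hmod hmodP hGZK hCM hKob hYZ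
    Wuthrich2014.lemma20_surjective_threeAdic_of_semistable_holds hLLT hr

/-- Equivalently, on thirteen named facts: a pair of analytic rank `≤ 1` at which `BSD(E,p)` is
not (yet) known lies in a residual class. `residual_of_not_bsdp` with the Lemma-20 binder
discharged. [folklore] -/
theorem residual_of_not_bsdp_noL20 (hSk : Skinner2016.thmC_padicValRat_bsd_rank_zero)
    (hBCS : BurungaleCastellaSkinner2025.cor131_padicValRat_bsd_rank_le_one)
    (hJSW : JetchevSkinnerWan2017.thm121_padicValRat_bsd_rank_one)
    (hCGS : CastellaGrossiSkinner2025.thmD_padicValRat_bsd_rank_le_one)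
    (hGV : GreenbergVatsal2000.thm13_charIdeal_eq_of_gvPar) (hGr : greenberg_charValue_rankZero)
    (hmod : hasEntireLFunction_rat) (hmodP : nonempty_modularParametrizationData)
    (hGZK : rank_eq_analyticRank_of_analyticRank_le_one)
    (hCM : bsdTriple_of_hasCM_of_L_one_ne_zero) (hKob : Kobayashi2013.cor14_bsdp_of_cm_rank_one)
    (hYZ : YanZhu2026.thm415_padicValRat_bsd_rank_le_one)
    (hLLT : LiLiuTian2024.thm11_bsdp_of_cm_rank_one)
    (hr : W.analyticRank ≤ 1) (hn : ¬ BSDp W p) : Residual W p :=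
  (bsdp_or_residual_noL20 hSk hBCS hJSW hCGS hGV hGr hmod hmodP hGZK hCM hKob hYZ hLLT hr).resolve_left
    hn

/-! ### The strong partial theorem on thirteen facts -/

/-- **STRONG PARTIAL THEOREM (non-CM form), thirteen named facts.** For `W/ℚ` globally minimal
elliptic, NON-CM, of analytic rank `r ≤ 1`, and an ODD prime `p` with `p` good, or `p`
multiplicative and `r = 0`: `BSD(E,p)` holds unless `(W, p)` lies in one of the eight named
corners X1, X9, X10b, X6 ∧ `r = 0`, X7, X8, X11a, X2 (RESIDUAL-MAP §A/§B/§C). `bsdp_of_not_corner`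
with the Lemma-20 binder discharged by `…_holds`. [folklore] -/
theorem bsdp_of_not_corner_noL20 (hSk : Skinner2016.thmC_padicValRat_bsd_rank_zero)
    (hBCS : BurungaleCastellaSkinner2025.cor131_padicValRat_bsd_rank_le_one)
    (hJSW : JetchevSkinnerWan2017.thm121_padicValRat_bsd_rank_one)
    (hCGS : CastellaGrossiSkinner2025.thmD_padicValRat_bsd_rank_le_one)
    (hGV : GreenbergVatsal2000.thm13_charIdeal_eq_of_gvPar) (hGr : greenberg_charValue_rankZero)
    (hmod : hasEntireLFunction_rat) (hmodP : nonempty_modularParametrizationData)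
    (hGZK : rank_eq_analyticRank_of_analyticRank_le_one)
    (hCM : bsdTriple_of_hasCM_of_L_one_ne_zero) (hKob : Kobayashi2013.cor14_bsdp_of_cm_rank_one)
    (hYZ : YanZhu2026.thm415_padicValRat_bsd_rank_le_one)
    (hLLT : LiLiuTian2024.thm11_bsdp_of_cm_rank_one)
    (hr : W.analyticRank ≤ 1) (hcm : ¬ W.HasCM) (hp : p ≠ 2)
    (hdom : Good W p ∨ (Mult W p ∧ W.analyticRank = 0))
    (hX1 : ¬ ClassX1 W p) (hX9 : ¬ ClassX9 W p) (hX10b : ¬ (ClassX10 W p ∧ ¬ Surj W p))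
    (hX6 : ¬ (ClassX6 W p ∧ W.analyticRank = 0)) (hX7 : ¬ ClassX7 W p) (hX8 : ¬ ClassX8 W p)
    (hX11a : ¬ ClassX11a W p) (hX2 : ¬ ClassX2 W p) : BSDp W p :=
  bsdp_of_not_corner hSk hBCS hJSW hCGS hGV hGr hmod hmodP hGZK hCM hKob hYZ
    Wuthrich2014.lemma20_surjective_threeAdic_of_semistable_holds hLLT hr hcm hp hdom hX1 hX9 hX10b
    hX6 hX7 hX8 hX11a hX2

/-- **STRONG PARTIAL THEOREM, every `E/ℚ` (CM included), thirteen named facts.** For `W/ℚ`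
globally minimal elliptic of analytic rank `r ≤ 1` and an ODD prime `p` with `p` good, or `p`
multiplicative and `r = 0`: `BSD(E,p)` holds unless `(W, p)` lies in one of the eight named NON-CM
corners X1, X9, X10b, X6 ∧ `r = 0`, X7, X8, X11a, X2 — the coordinator's wording
(2026-08-20T22:24Z) as one kernel statement; `bsdp_of_not_corner'` with the Lemma-20 binder
discharged by `…_holds`. [folklore] -/
theorem bsdp_of_not_corner_noL20' (hSk : Skinner2016.thmC_padicValRat_bsd_rank_zero)
    (hBCS : BurungaleCastellaSkinner2025.cor131_padicValRat_bsd_rank_le_one)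
    (hJSW : JetchevSkinnerWan2017.thm121_padicValRat_bsd_rank_one)
    (hCGS : CastellaGrossiSkinner2025.thmD_padicValRat_bsd_rank_le_one)
    (hGV : GreenbergVatsal2000.thm13_charIdeal_eq_of_gvPar) (hGr : greenberg_charValue_rankZero)
    (hmod : hasEntireLFunction_rat) (hmodP : nonempty_modularParametrizationData)
    (hGZK : rank_eq_analyticRank_of_analyticRank_le_one)
    (hCM : bsdTriple_of_hasCM_of_L_one_ne_zero) (hKob : Kobayashi2013.cor14_bsdp_of_cm_rank_one)
    (hYZ : YanZhu2026.thm415_padicValRat_bsd_rank_le_one)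
    (hLLT : LiLiuTian2024.thm11_bsdp_of_cm_rank_one)
    (hr : W.analyticRank ≤ 1) (hp : p ≠ 2)
    (hdom : Good W p ∨ (Mult W p ∧ W.analyticRank = 0))
    (hX1 : ¬ ClassX1 W p) (hX9 : ¬ ClassX9 W p) (hX10b : ¬ (ClassX10 W p ∧ ¬ Surj W p))
    (hX6 : ¬ (ClassX6 W p ∧ W.analyticRank = 0)) (hX7 : ¬ ClassX7 W p) (hX8 : ¬ ClassX8 W p)
    (hX11a : ¬ ClassX11a W p) (hX2 : ¬ ClassX2 W p) : BSDp W p :=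
  bsdp_of_not_corner' hSk hBCS hJSW hCGS hGV hGr hmod hmodP hGZK hCM hKob hYZ
    Wuthrich2014.lemma20_surjective_threeAdic_of_semistable_holds hLLT hr hp hdom hX1 hX9 hX10b hX6
    hX7 hX8 hX11a hX2

/-- **All curves, every prime, corner form with the CM corner explicit, thirteen named facts**: for
`W/ℚ` of analytic rank `≤ 1` and a prime `p` in the domain "`p` odd and (good, or multiplicative
with `r = 0`)" OR "`W` has CM" (any `p`), `BSD(E,p)` holds outside the eight non-CM corners (read
when `¬ cm`) and outside `CornerF` (read when `cm`). `bsdp_allCurves_of_not_corner_of_not_cornerF`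
(RESIDUAL-MAP §I HEADLINE in kernel form) with the Lemma-20 binder discharged. [folklore] -/
theorem bsdp_allCurves_of_not_corner_of_not_cornerF_noL20
    (hSk : Skinner2016.thmC_padicValRat_bsd_rank_zero)
    (hBCS : BurungaleCastellaSkinner2025.cor131_padicValRat_bsd_rank_le_one)
    (hJSW : JetchevSkinnerWan2017.thm121_padicValRat_bsd_rank_one)
    (hCGS : CastellaGrossiSkinner2025.thmD_padicValRat_bsd_rank_le_one)
    (hGV : GreenbergVatsal2000.thm13_charIdeal_eq_of_gvPar) (hGr : greenberg_charValue_rankZero)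
    (hmod : hasEntireLFunction_rat) (hmodP : nonempty_modularParametrizationData)
    (hGZK : rank_eq_analyticRank_of_analyticRank_le_one)
    (hCM : bsdTriple_of_hasCM_of_L_one_ne_zero) (hKob : Kobayashi2013.cor14_bsdp_of_cm_rank_one)
    (hYZ : YanZhu2026.thm415_padicValRat_bsd_rank_le_one)
    (hLLT : LiLiuTian2024.thm11_bsdp_of_cm_rank_one)
    (hr : W.analyticRank ≤ 1)
    (hdom : W.HasCM ∨ (p ≠ 2 ∧ (Good W p ∨ (Mult W p ∧ W.analyticRank = 0))))
    (hA : ¬ W.HasCM → ¬ ClassX1 W p ∧ ¬ ClassX9 W p ∧ ¬ (ClassX10 W p ∧ ¬ Surj W p) ∧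
      ¬ (ClassX6 W p ∧ W.analyticRank = 0) ∧ ¬ ClassX7 W p ∧ ¬ ClassX8 W p ∧
      ¬ ClassX11a W p ∧ ¬ ClassX2 W p)
    (hF : W.HasCM → ¬ CornerF W p) : BSDp W p :=
  bsdp_allCurves_of_not_corner_of_not_cornerF hSk hBCS hJSW hCGS hGV hGr hmod hmodP hGZK hCM hKob
    hYZ Wuthrich2014.lemma20_surjective_threeAdic_of_semistable_holds hLLT hr hdom hA hF

/-- **STRONG PARTIAL THEOREM AT `p = 3`, every `E/ℚ`, thirteen named facts** (RESIDUAL-MAP §S.5):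
for `W/ℚ` globally minimal elliptic (CM or not) of analytic rank `r ≤ 1`, with `3` good, or `3`
multiplicative and `r = 0`: `BSD(E,3)` holds unless `(W, 3)` lies in one of the SEVEN named
corners at `3` — X10b, X1@3, X6@3 ∧ `r = 0`, X7@3, X8, X11a@3, X2@3. `p = 3` is the only prime
at which Wuthrich's Lemma 20 has content; `bsdp_three_of_not_corner` with that binder discharged by
`…_holds`. [folklore] -/
theorem bsdp_three_of_not_corner_noL20 (hSk : Skinner2016.thmC_padicValRat_bsd_rank_zero)
    (hBCS : BurungaleCastellaSkinner2025.cor131_padicValRat_bsd_rank_le_one)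
    (hJSW : JetchevSkinnerWan2017.thm121_padicValRat_bsd_rank_one)
    (hCGS : CastellaGrossiSkinner2025.thmD_padicValRat_bsd_rank_le_one)
    (hGV : GreenbergVatsal2000.thm13_charIdeal_eq_of_gvPar) (hGr : greenberg_charValue_rankZero)
    (hmod : hasEntireLFunction_rat) (hmodP : nonempty_modularParametrizationData)
    (hGZK : rank_eq_analyticRank_of_analyticRank_le_one)
    (hCM : bsdTriple_of_hasCM_of_L_one_ne_zero) (hKob : Kobayashi2013.cor14_bsdp_of_cm_rank_one)
    (hYZ : YanZhu2026.thm415_padicValRat_bsd_rank_le_one)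
    (hLLT : LiLiuTian2024.thm11_bsdp_of_cm_rank_one)
    (hr : W.analyticRank ≤ 1) (hdom : Good W 3 ∨ (Mult W 3 ∧ W.analyticRank = 0))
    (hX10b : ¬ (ClassX10 W 3 ∧ ¬ Surj W 3)) (hX1 : ¬ ClassX1 W 3)
    (hX6 : ¬ (ClassX6 W 3 ∧ W.analyticRank = 0)) (hX7 : ¬ ClassX7 W 3) (hX8 : ¬ ClassX8 W 3)
    (hX11a : ¬ ClassX11a W 3) (hX2 : ¬ ClassX2 W 3) : BSDp W 3 :=
  bsdp_three_of_not_corner hSk hBCS hJSW hCGS hGV hGr hmod hmodP hGZK hCM hKob hYZ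
    Wuthrich2014.lemma20_surjective_threeAdic_of_semistable_holds hLLT hr hdom hX10b hX1 hX6 hX7 hX8
    hX11a hX2

end Curve

end Summit.BirchSwinnertonDyer.Rank1Residual
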